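import Literature.NumberTheory.Sieve.CFSemigroupCountPowerSavingPrep
import HarnessLib

/-!
# Power saving for the congruence Frobenius-ball count of `Γ_A` at a fixed level, from operator bounds

[MageeOhWinter2019, Thm. 1 / Thm. 11] at a level `q`: `#{γ ∈ Γ_A : ‖γ‖_F ≤ R, γ ≡ ξ (q)} = c R^{2δ_A}/#SL₂(ℤ/qℤ) + O(K R^{2δ_A−ε})`.
This file PROVES the last step of [MageeOhWinter2019, §3.4] (after Prop. 17: the passage from the boundary renewal counts of
all suffixes of length `N ≍ log R` to the ball count, with the pressure controlling the suffix sum), in the form: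

**Theorem** (`abs_cfCount_sub_le_of_operatorBound`). Fix `A` (`#A ≥ 2`, letters `≥ 1`), a level `q`, `0 ≤ σ₀ < σ₁ < δ_A`,
`0 ≤ κ < 2`, `M ≥ 0`. Assume the unit hypotheses (`1 − L_s` a unit for `Re s > σ₀`, `s ≠ δ_A`; `1 + L_s`, `1 − B_s` units for
`Re s > σ₀`) and the sup-norm bound `‖(H_op(u+it)(Φ₀^{-2(u+it)} ⊗ δ_1))_η(y)‖ ≤ M(1+|t|)^κ` on `σ₁ ≤ u ≤ δ_A+1` (`u+it ≠ δ_A`)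
for the regular part `H_op` of the twisted resolvent (`cfTwHop`). Let `l` be bracketed by the per-suffix constants,
`|Γ_q|^{-1} L_N ≤ l ≤ |Γ_q|^{-1} U_N` for all even `N ≠ 0` with `η̄_N ≤ 1/16` (this holds for the limit
`l = lim cfCount A q ξ R / R^{2δ}` whenever it exists, e.g. for primitive twists: `bracket_of_tendsto`). Then for all `R ≥ 1`

  `|cfCount A q ξ R − l R^{2δ_A}| ≤ K(M) · R^{2δ_A − η}`,

with `η = cfPSExp A σ₁ > 0` depending only on `A, σ₁` and `K(M) = cfPSConst A … σ₁ κ M` AFFINE in `M` with coefficients depending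
only on `A, σ₁, κ` (not on `q`, `ξ`) (`cfPSConst_eq_affine`).

**Theorem** (`uniformCounting_of_operatorBounds`): consequently, if the unit hypotheses hold and the sup-norm bound holds with
`M = K_c q^C` for all levels `q` coprime to some `Q₁` (the formal content of [MageeOhWinter2019, Thm. 4] in resolvent form), then the
conclusion of the named fact `MageeOhWinter2019_uniformCounting` holds for `A` (with `Q₀ = 6|b−a|Q₁`, the `q`-independent `c` of
Thm. 1, `ε = cfPSExp A σ₁`, exponent `C+1`). What remains unproved towards that fact is exactly this level-uniform operator input.

## References
* [MageeOhWinter2019] M. Magee, H. Oh, D. Winter, J. reine angew. Math. 753 (2019), §3.4 (after Prop. 17), Lemma 13, Thm. 4, Thm. 11.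
-/

noncomputable section

open Complex Filter Set Metric Real
open scoped Topology MatrixGroups

namespace Literature.NumberTheory.Sieve

open Literature.NumberTheory.LFunctions

variable {A : Finset ℕ}

/-! ### Small combinatorial facts -/

/-- `#(Fin n → A) = #A ^ n`. [folklore] -/
theorem card_words_eq (n : ℕ) : ((Fintype.card (Fin n → A) : ℕ) : ℝ) = (A.card : ℝ) ^ n := by
  rw [Fintype.card_fun, Fintype.card_fin, Fintype.card_coe]; push_cast; ring

/-- `Σ_{n<N} k^n ≤ k^N` for `k ≥ 2`. [folklore] -/
theorem geom_sum_le_pow {k : ℝ} (hk : 2 ≤ k) (N : ℕ) : ∑ n ∈ Finset.range N, k ^ n ≤ k ^ N := by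
  induction N with
  | zero => simp
  | succ N ih =>
    rw [Finset.sum_range_succ, pow_succ]
    nlinarith [pow_nonneg (by linarith : (0 : ℝ) ≤ k) N]

/-- The short words: `Σ_{n<N} N_n^{norm}(R; ξ) ≤ #A^N`. [folklore] -/
theorem sum_short_le (h2 : 2 ≤ A.card) (q : ℕ) (ξ : SL(2, ZMod q)) (N : ℕ) (R : ℝ) :
    ∑ n ∈ Finset.range N, cfLenNormCountC A q ξ n R ≤ (A.card : ℝ) ^ N := by
  refine (sum_cfLenNormCountC_le (A := A) q ξ N R).trans ?_
  rw [Finset.sum_congr rfl fun n _ => card_words_eq (A := A) n]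
  exact geom_sum_le_pow (by exact_mod_cast h2) N

/-! ### The scaling factors `a₊(v)`, `a₋(v)` of the sandwich -/

variable (A) in
/-- `a₊(v) = e^{8η̄_N}/√C_v`. [cite: MageeOhWinter2019, Lemma 13] -/
def cfAPlus (N : ℕ) (v : Fin N → A) : ℝ :=
  Real.exp (8 * cfEtaBar N) / Real.sqrt (‖cfDenC (cfMat fun i => ((v i : A) : ℕ)) Complex.I‖ ^ 2)

variable (A) in
/-- `a₋(v) = e^{-5η̄_N}/√C_v`. [cite: MageeOhWinter2019, Lemma 13] -/
def cfAMinus (N : ℕ) (v : Fin N → A) : ℝ :=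
  Real.exp (-(5 * cfEtaBar N)) / Real.sqrt (‖cfDenC (cfMat fun i => ((v i : A) : ℕ)) Complex.I‖ ^ 2)

/-- `a₊(v) ≥ 0`. [folklore] -/
theorem cfAPlus_nonneg (N : ℕ) (v : Fin N → A) : 0 ≤ cfAPlus A N v :=
  div_nonneg (Real.exp_pos _).le (Real.sqrt_nonneg _)

/-- `a₋(v) ≥ 0`. [folklore] -/
theorem cfAMinus_nonneg (N : ℕ) (v : Fin N → A) : 0 ≤ cfAMinus A N v :=
  div_nonneg (Real.exp_pos _).le (Real.sqrt_nonneg _)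

/-- `a₋(v) ≤ a₊(v)`. [folklore] -/
theorem cfAMinus_le_cfAPlus (hA : ∀ a ∈ A, 1 ≤ a) (N : ℕ) (v : Fin N → A) : cfAMinus A N v ≤ cfAPlus A N v :=
  div_le_div_of_nonneg_right (Real.exp_le_exp.2 (by linarith [cfEtaBar_nonneg N])) (sqrt_Cv_pos A hA v).le

/-- `U_N = Σ_v a₊(v)^{2δ} c_v`. [folklore] -/
theorem cfClassUpper_eq_sum (hA : ∀ a ∈ A, 1 ≤ a) (h2 : 2 ≤ A.card) (N : ℕ) :
    cfClassUpper A hA h2 N = ∑ v : Fin N → A, cfAPlus A N v ^ (2 * cfDimension A) *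
      cfEvenConst A hA h2 cfΘ₀ (CfLip.const 1) (cfXvI A hA v) := rfl

/-- `L_N = Σ_v a₋(v)^{2δ} c_v`. [folklore] -/
theorem cfClassLower_eq_sum (hA : ∀ a ∈ A, 1 ≤ a) (h2 : 2 ≤ A.card) (N : ℕ) :
    cfClassLower A hA h2 N = ∑ v : Fin N → A, cfAMinus A N v ^ (2 * cfDimension A) *
      cfEvenConst A hA h2 cfΘ₀ (CfLip.const 1) (cfXvI A hA v) := rfl

/-! ### The two-sided bound for a fixed suffix length `N` -/

section FixedN

variable (hA : ∀ a ∈ A, 1 ≤ a) (h2 : 2 ≤ A.card) {q : ℕ} [NeZero q]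

/-- **The bound for a fixed even suffix length `N`:** under the operator hypotheses, for `l` bracketed by
`|Γ_q|^{-1}L_N ≤ l ≤ |Γ_q|^{-1}U_N`, `R ≥ 0`:
`|cfCount A q ξ R − l R^{2δ}| ≤ #A^N (1 + K₀) + 13·2δ·e^{2δ}(c_max 4^δ) η̄_N R^{2δ} + K_st e^{2δ} 4^δ e^{Nθ log(B+1)} R^{2δ−θ}`,
`θ = 2(δ−σ₁)/3`. [cite: MageeOhWinter2019, §3.4 (after Prop. 17)] -/
theorem abs_cfCount_sub_le_fixedN {σ₀ σ₁ : ℝ} (hσ₀ : 0 ≤ σ₀) (hσ₀₁ : σ₀ < σ₁) (hσ₁ : σ₁ < cfDimension A)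
    (hL1 : ∀ s : ℂ, σ₀ < s.re → s ≠ (cfDimension A : ℂ) → IsUnit (1 - cfLOp A hA s))
    (hL2 : ∀ s : ℂ, σ₀ < s.re → IsUnit (1 + cfLOp A hA s))
    (hB : ∀ s : ℂ, σ₀ < s.re → IsUnit (1 - cfTwB A hA q s))
    {κ M : ℝ} (hκ0 : 0 ≤ κ) (hκ : κ < 2) (hM : 0 ≤ M)
    (hop : ∀ u : ℝ, σ₁ ≤ u → u ≤ cfDimension A + 1 → ∀ t : ℝ, (u : ℂ) + t * I ≠ (cfDimension A : ℂ) →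
      ∀ (η : SL(2, ZMod q)) (y : Icc (0 : ℝ) 1),
        ‖(cfTwHop A hA h2 q ((u : ℂ) + t * I) (cfFamS q cfΘ₀ (CfLip.const 1) 1 ((u : ℂ) + t * I))) η y‖ ≤ M * (1 + |t|) ^ κ)
    (ξ : SL(2, ZMod q)) {l : ℝ} {N : ℕ} (hNev : Even N) (hN0 : N ≠ 0) (hη : cfEtaBar N ≤ 1 / 16)
    (hlL : ((Fintype.card (SL(2, ZMod q)) : ℝ))⁻¹ * cfClassLower A hA h2 N ≤ l)
    (hlU : l ≤ ((Fintype.card (SL(2, ZMod q)) : ℝ))⁻¹ * cfClassUpper A hA h2 N) {R : ℝ} (hR : 0 ≤ R) :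
    |(cfCount A q ξ R : ℝ) - l * R ^ (2 * cfDimension A)| ≤
      (A.card : ℝ) ^ N * (1 + cfK0 A hA h2 σ₁ κ M) +
        13 * (2 * cfDimension A) * Real.exp (2 * cfDimension A) * (cfCmax A hA h2 * (4 : ℝ) ^ cfDimension A) * cfEtaBar N *
          R ^ (2 * cfDimension A) +
        cfKst A hA h2 σ₁ κ M * (Real.exp (2 * cfDimension A) * (4 : ℝ) ^ cfDimension A *
          Real.exp (N * ((2 * ((cfDimension A - σ₁) / 3)) * Real.log ((A.sup id : ℕ) + 1)))) *
          R ^ (2 * cfDimension A - 2 * ((cfDimension A - σ₁) / 3)) := by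
  have hne := nonempty_of_two_le_card h2
  have hδ := cfDimension_pos hA h2
  have hσ₁0 : 0 < σ₁ := lt_of_le_of_lt hσ₀ hσ₀₁
  have hKst := cfKst_nonneg hA h2 (κ := κ) hσ₁0 hM
  have hK0 : 0 ≤ cfK0 A hA h2 σ₁ κ M := by
    unfold cfK0; have := (cfCmax_pos A hA h2).le; positivity
  -- abbreviations (atoms for `linarith`)
  obtain ⟨p, hp⟩ : ∃ p : ℝ, p = 2 * cfDimension A := ⟨_, rfl⟩
  obtain ⟨θ, hθ⟩ : ∃ θ : ℝ, θ = 2 * ((cfDimension A - σ₁) / 3) := ⟨_, rfl⟩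
  have hθ0 : 0 ≤ θ := by rw [hθ]; linarith
  have hθp : θ ≤ p := by rw [hθ, hp]; linarith
  obtain ⟨ci, hci⟩ : ∃ ci : ℝ, ci = ((Fintype.card (SL(2, ZMod q)) : ℝ))⁻¹ := ⟨_, rfl⟩
  have hci0 : 0 ≤ ci := by rw [hci]; positivity
  have hci1 : ci ≤ 1 := by rw [hci]; exact inv_le_one_of_one_le₀ (by exact_mod_cast Fintype.card_pos)
  have hRp : 0 ≤ R ^ p := rpow_nonneg hR _
  have hRpθ : 0 ≤ R ^ (p - θ) := rpow_nonneg hR _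
  -- the count decomposition and the sandwich
  have hcount : (cfCount A q ξ R : ℝ) =
      ∑ n ∈ Finset.range N, cfLenNormCountC A q ξ n R + ∑ v : Fin N → A, cfSuffixCountC A q ξ v R := by
    rw [cfCount_eq_tsum_congr hA hne q ξ R, tsum_cfLenNormCountC_split hA q ξ hNev hN0 R]
  have hshort0 : 0 ≤ ∑ n ∈ Finset.range N, cfLenNormCountC A q ξ n R :=
    Finset.sum_nonneg fun n _ => cfLenNormCountC_nonneg q ξ n R
  have hshort := sum_short_le h2 q ξ N R
  have hsand := fun v : Fin N → A => cfSuffixCountC_sandwich hA q ξ hNev hη v hR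
  have hcardR : ((Finset.univ : Finset (Fin N → A)).card : ℝ) = (A.card : ℝ) ^ N := by
    rw [Finset.card_univ]; exact card_words_eq (A := A) N
  -- per-suffix bounds (upper at `a₊ R`, lower at `a₋ R`)
  have hper : ∀ (v : Fin N → A) (a : ℝ), 0 ≤ a →
      |cfCongCountT A cfΘ₀ (CfLip.const 1) (ξ * (cfRed q (cfEvenWordSL hNev v))⁻¹) 1 (a * R) (cfXvI A hA v) -
          ci * cfEvenConst A hA h2 cfΘ₀ (CfLip.const 1) (cfXvI A hA v) * (a ^ p * R ^ p)| ≤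
        cfKst A hA h2 σ₁ κ M * (a ^ (p - θ) * R ^ (p - θ)) + cfK0 A hA h2 σ₁ κ M := by
    intro v a ha
    have h := abs_cfCongCountT_sub_le_all hA h2 hσ₀ hσ₀₁ hσ₁ hL1 hL2 hB hκ0 hκ hM hop
      (ξ * (cfRed q (cfEvenWordSL hNev v))⁻¹) (cfXvI A hA v) (Y := a * R) (mul_nonneg ha hR)
    rw [← hp, ← hci, show p - 2 * ((cfDimension A - σ₁) / 3) = p - θ by rw [hθ], Real.mul_rpow ha hR,
      Real.mul_rpow ha hR] at h
    exact h
  -- the upper sum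
  have hsumU : ∑ v : Fin N → A, cfCongCountT A cfΘ₀ (CfLip.const 1) (ξ * (cfRed q (cfEvenWordSL hNev v))⁻¹) 1 (cfAPlus A N v * R)
      (cfXvI A hA v) ≤ ci * R ^ p * cfClassUpper A hA h2 N +
        cfKst A hA h2 σ₁ κ M * R ^ (p - θ) * (∑ v : Fin N → A, cfAPlus A N v ^ (p - θ)) + (A.card : ℝ) ^ N * cfK0 A hA h2 σ₁ κ M := by
    have hle : ∀ v ∈ (Finset.univ : Finset (Fin N → A)),
        cfCongCountT A cfΘ₀ (CfLip.const 1) (ξ * (cfRed q (cfEvenWordSL hNev v))⁻¹) 1 (cfAPlus A N v * R) (cfXvI A hA v) ≤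
          ci * R ^ p * (cfAPlus A N v ^ p * cfEvenConst A hA h2 cfΘ₀ (CfLip.const 1) (cfXvI A hA v)) +
            cfKst A hA h2 σ₁ κ M * R ^ (p - θ) * cfAPlus A N v ^ (p - θ) + cfK0 A hA h2 σ₁ κ M := by
      intro v _
      have h := (abs_le.1 (hper v (cfAPlus A N v) (cfAPlus_nonneg N v))).2
      nlinarith [h]
    refine (Finset.sum_le_sum hle).trans (le_of_eq ?_)
    rw [Finset.sum_add_distrib, Finset.sum_add_distrib, Finset.sum_const, nsmul_eq_mul, hcardR, ← Finset.mul_sum,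
      ← Finset.mul_sum, cfClassUpper_eq_sum hA h2 N, hp]
  -- the lower sum
  have hsumL : ci * R ^ p * cfClassLower A hA h2 N -
      cfKst A hA h2 σ₁ κ M * R ^ (p - θ) * (∑ v : Fin N → A, cfAMinus A N v ^ (p - θ)) - (A.card : ℝ) ^ N * cfK0 A hA h2 σ₁ κ M ≤
      ∑ v : Fin N → A, cfCongCountT A cfΘ₀ (CfLip.const 1) (ξ * (cfRed q (cfEvenWordSL hNev v))⁻¹) 1 (cfAMinus A N v * R)
        (cfXvI A hA v) := by
    have hle : ∀ v ∈ (Finset.univ : Finset (Fin N → A)),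
        ci * R ^ p * (cfAMinus A N v ^ p * cfEvenConst A hA h2 cfΘ₀ (CfLip.const 1) (cfXvI A hA v)) -
            cfKst A hA h2 σ₁ κ M * R ^ (p - θ) * cfAMinus A N v ^ (p - θ) - cfK0 A hA h2 σ₁ κ M ≤
          cfCongCountT A cfΘ₀ (CfLip.const 1) (ξ * (cfRed q (cfEvenWordSL hNev v))⁻¹) 1 (cfAMinus A N v * R) (cfXvI A hA v) := by
      intro v _
      have h := (abs_le.1 (hper v (cfAMinus A N v) (cfAMinus_nonneg N v))).1
      nlinarith [h]
    refine (le_of_eq ?_).trans (Finset.sum_le_sum hle)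
    rw [Finset.sum_sub_distrib, Finset.sum_sub_distrib, Finset.sum_const, nsmul_eq_mul, hcardR, ← Finset.mul_sum,
      ← Finset.mul_sum, cfClassLower_eq_sum hA h2 N, hp]
  -- sandwich of the suffix sums
  have hSL : ∑ v : Fin N → A, cfCongCountT A cfΘ₀ (CfLip.const 1) (ξ * (cfRed q (cfEvenWordSL hNev v))⁻¹) 1 (cfAMinus A N v * R)
      (cfXvI A hA v) ≤ ∑ v : Fin N → A, cfSuffixCountC A q ξ v R := by
    refine Finset.sum_le_sum fun v _ => ?_
    have h := (hsand v).1
    rwa [show R * Real.exp (-(5 * cfEtaBar N)) / Real.sqrt (‖cfDenC (cfMat fun i => ((v i : A) : ℕ)) Complex.I‖ ^ 2) =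
      cfAMinus A N v * R by unfold cfAMinus; ring] at h
  have hSU : ∑ v : Fin N → A, cfSuffixCountC A q ξ v R ≤ ∑ v : Fin N → A, cfCongCountT A cfΘ₀ (CfLip.const 1)
      (ξ * (cfRed q (cfEvenWordSL hNev v))⁻¹) 1 (cfAPlus A N v * R) (cfXvI A hA v) := by
    refine Finset.sum_le_sum fun v _ => ?_
    have h := (hsand v).2
    rwa [show R * Real.exp (8 * cfEtaBar N) / Real.sqrt (‖cfDenC (cfMat fun i => ((v i : A) : ℕ)) Complex.I‖ ^ 2) =
      cfAPlus A N v * R by unfold cfAPlus; ring] at h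
  -- the sums of scaling factors
  have hSP : ∑ v : Fin N → A, cfAPlus A N v ^ (p - θ) ≤ Real.exp p * (4 : ℝ) ^ cfDimension A *
      Real.exp (N * (θ * Real.log ((A.sup id : ℕ) + 1))) := by
    have h := sum_aPlus_rpow_le A hA h2 hη hθ0 (by rw [hp] at hθp; exact hθp)
    rw [← hp] at h
    exact h
  have hSMP : ∑ v : Fin N → A, cfAMinus A N v ^ (p - θ) ≤ ∑ v : Fin N → A, cfAPlus A N v ^ (p - θ) :=
    Finset.sum_le_sum fun v _ => rpow_le_rpow (cfAMinus_nonneg N v) (cfAMinus_le_cfAPlus hA N v) (by linarith)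
  -- `U_N − L_N` and the bracket of `l`
  have hUL := cfClassUpper_sub_cfClassLower_le A hA h2 hη
  rw [← hci] at hlL hlU
  rw [← hp] at hUL ⊢
  have h1 : ci * R ^ p * cfClassUpper A hA h2 N - ci * R ^ p * cfClassLower A hA h2 N ≤
      13 * p * Real.exp p * (cfCmax A hA h2 * (4 : ℝ) ^ cfDimension A) * cfEtaBar N * R ^ p := by
    have hE0 : 0 ≤ 13 * p * Real.exp p * (cfCmax A hA h2 * (4 : ℝ) ^ cfDimension A) * cfEtaBar N := by
      have := (cfCmax_pos A hA h2).le; have := cfEtaBar_nonneg N; have : 0 ≤ p := by rw [hp]; linarith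
      positivity
    have hUL0 : 0 ≤ cfClassUpper A hA h2 N - cfClassLower A hA h2 N := by
      rw [cfClassUpper_eq A hA h2 N, ← sub_one_mul]
      refine mul_nonneg ?_ ?_
      · have : 0 ≤ 13 * cfEtaBar N * (2 * cfDimension A) := by have := cfEtaBar_nonneg N; positivity
        linarith [Real.add_one_le_exp (13 * cfEtaBar N * (2 * cfDimension A))]
      · unfold cfClassLower
        exact Finset.sum_nonneg fun v _ => mul_nonneg (rpow_nonneg (cfAMinus_nonneg N v) _) (cfEvenConst_one_nonneg A hA h2 _)
    rw [← mul_sub]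
    calc ci * R ^ p * (cfClassUpper A hA h2 N - cfClassLower A hA h2 N)
        ≤ 1 * R ^ p * (13 * p * Real.exp p * (cfCmax A hA h2 * (4 : ℝ) ^ cfDimension A) * cfEtaBar N) :=
          mul_le_mul (mul_le_mul_of_nonneg_right hci1 hRp) hUL hUL0 (by positivity)
      _ = _ := by ring
  have h2' : l * R ^ p ≤ ci * R ^ p * cfClassUpper A hA h2 N := by nlinarith [mul_le_mul_of_nonneg_right hlU hRp]
  have h3 : ci * R ^ p * cfClassLower A hA h2 N ≤ l * R ^ p := by nlinarith [mul_le_mul_of_nonneg_right hlL hRp]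
  have h4 : cfKst A hA h2 σ₁ κ M * R ^ (p - θ) * (∑ v : Fin N → A, cfAPlus A N v ^ (p - θ)) ≤
      cfKst A hA h2 σ₁ κ M * R ^ (p - θ) * (Real.exp p * (4 : ℝ) ^ cfDimension A *
        Real.exp (N * (θ * Real.log ((A.sup id : ℕ) + 1)))) :=
    mul_le_mul_of_nonneg_left hSP (mul_nonneg hKst hRpθ)
  have h5 : cfKst A hA h2 σ₁ κ M * R ^ (p - θ) * (∑ v : Fin N → A, cfAMinus A N v ^ (p - θ)) ≤
      cfKst A hA h2 σ₁ κ M * R ^ (p - θ) * (∑ v : Fin N → A, cfAPlus A N v ^ (p - θ)) :=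
    mul_le_mul_of_nonneg_left hSMP (mul_nonneg hKst hRpθ)
  have hAN : 0 ≤ (A.card : ℝ) ^ N := by positivity
  have hANK := mul_nonneg hAN hK0
  rw [hθ] at h4 h5 hsumU hsumL
  rw [abs_le]
  constructor
  · linarith [hcount, hSL, hsumL, h2', h5, h4, hshort0]
  · linarith [hcount, hSU, hsumU, h3, h1, h4, hshort]

end FixedN

/-! ### Choosing `N ≍ log R`: three elementary estimates -/

/-- `k^N ≤ k² R^δ` when `N ≤ c₀ log R + 2` and `c₀ log k ≤ δ` (`k ≥ 1`, `R ≥ 1`). [folklore] -/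
theorem pow_le_sq_mul_rpow {k c₀ δ R : ℝ} {N : ℕ} (hk : 1 ≤ k) (hR : 1 ≤ R) (hN : (N : ℝ) ≤ c₀ * Real.log R + 2)
    (hck : c₀ * Real.log k ≤ δ) : k ^ N ≤ k ^ 2 * R ^ δ := by
  have hk0 : 0 < k := by linarith
  have hR0 : 0 < R := by linarith
  have hlogR : 0 ≤ Real.log R := Real.log_nonneg hR
  calc k ^ N = k ^ (N : ℝ) := (rpow_natCast k N).symm
    _ ≤ k ^ (c₀ * Real.log R + 2) := Real.rpow_le_rpow_of_exponent_le hk hN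
    _ = k ^ (c₀ * Real.log R) * k ^ 2 := by rw [Real.rpow_add hk0, show (2 : ℝ) = ((2 : ℕ) : ℝ) by norm_num, rpow_natCast]
    _ ≤ R ^ δ * k ^ 2 := by
        refine mul_le_mul_of_nonneg_right ?_ (by positivity)
        rw [Real.rpow_def_of_pos hk0, Real.rpow_def_of_pos hR0]
        exact Real.exp_le_exp.2 (by nlinarith [mul_le_mul_of_nonneg_right hck hlogR])
    _ = k ^ 2 * R ^ δ := mul_comm _ _

/-- `η̄_N = (1/2)^{N−1} ≤ 2 R^{−c₀ log 2}` when `N ≥ c₀ log R`, `N ≥ 1` (`R ≥ 1`). [folklore] -/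
theorem cfEtaBar_le_rpow {c₀ R : ℝ} {N : ℕ} (hR : 1 ≤ R) (hN1 : 1 ≤ N) (hN : c₀ * Real.log R ≤ (N : ℝ)) :
    cfEtaBar N ≤ 2 * R ^ (-(c₀ * Real.log 2)) := by
  have hR0 : 0 < R := by linarith
  have heq : cfEtaBar N = 2 * (1 / 2 : ℝ) ^ (N : ℝ) := by
    rw [cfEtaBar, rpow_natCast]
    obtain ⟨m, rfl⟩ := Nat.exists_eq_add_of_le hN1
    rw [show 1 + m - 1 = m by omega, pow_add, pow_one]; ring
  rw [heq]
  refine mul_le_mul_of_nonneg_left ?_ (by norm_num)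
  calc (1 / 2 : ℝ) ^ (N : ℝ) ≤ (1 / 2 : ℝ) ^ (c₀ * Real.log R) :=
        Real.rpow_le_rpow_of_exponent_ge (by norm_num) (by norm_num) hN
    _ = R ^ (-(c₀ * Real.log 2)) := by
        rw [Real.rpow_def_of_pos (by norm_num : (0 : ℝ) < 1 / 2), Real.rpow_def_of_pos hR0,
          show Real.log (1 / 2 : ℝ) = -Real.log 2 by rw [one_div, Real.log_inv]]
        congr 1; ring

/-- `exp(N θ Λ_B) ≤ exp(2θΛ_B) R^{θ/2}` when `N ≤ c₀ log R + 2` and `c₀ Λ_B ≤ 1/2` (`θ, Λ_B ≥ 0`, `R ≥ 1`). [folklore] -/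
theorem exp_mul_le_rpow {c₀ θ LB R : ℝ} {N : ℕ} (hR : 1 ≤ R) (hθ : 0 ≤ θ) (hLB : 0 ≤ LB) (hN : (N : ℝ) ≤ c₀ * Real.log R + 2)
    (hc : c₀ * LB ≤ 1 / 2) : Real.exp (N * (θ * LB)) ≤ Real.exp (2 * θ * LB) * R ^ (θ / 2) := by
  have hR0 : 0 < R := by linarith
  have hlogR : 0 ≤ Real.log R := Real.log_nonneg hR
  rw [Real.rpow_def_of_pos hR0, ← Real.exp_add]
  refine Real.exp_le_exp.2 ?_
  have h1 : (N : ℝ) * (θ * LB) ≤ (c₀ * Real.log R + 2) * (θ * LB) := mul_le_mul_of_nonneg_right hN (by positivity)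
  nlinarith [mul_le_mul_of_nonneg_right hc (mul_nonneg hθ hlogR)]

/-! ### The constants of the theorem -/

section Constants

variable (A) (hA : ∀ a ∈ A, 1 ≤ a) (h2 : 2 ≤ A.card)

/-- `c₀ = min(δ/log #A, 1/(2 log(B+1)))`, the suffix-length rate (`N ≍ c₀ log R`). [folklore] -/
def cfPSc0 : ℝ := min (cfDimension A / Real.log A.card) (1 / (2 * Real.log ((A.sup id : ℕ) + 1)))

/-- **The power saving exponent** `η = min(δ, c₀ log 2, (δ − σ₁)/3) > 0` (depends only on `A` and `σ₁`). [folklore] -/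
def cfPSExp (σ₁ : ℝ) : ℝ := min (min (cfDimension A) (cfPSc0 A * Real.log 2)) ((cfDimension A - σ₁) / 3)

/-- The threshold radius `R₀ = e^{6/c₀}` beyond which `N(R) ≥ 6`. [folklore] -/
def cfPSR0 : ℝ := Real.exp (6 / cfPSc0 A)

/-- Hensley's uniform constant `c₂` (`cfCount A q ξ R ≤ c₂ R^{2δ}`, `R ≥ 1`, all `q`, `ξ`). [folklore] -/
def cfC2 : ℝ := Classical.choose (cfCount_le_uniform hA h2)

/-- The defining property of `c₂`. [folklore] -/
theorem cfC2_spec : 0 < cfC2 A hA h2 ∧ ∀ (q : ℕ) (ξ : SL(2, ZMod q)) (R : ℝ), 1 ≤ R →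
    (cfCount A q ξ R : ℝ) ≤ cfC2 A hA h2 * R ^ (2 * cfDimension A) :=
  Classical.choose_spec (cfCount_le_uniform hA h2)

/-- A uniform bound for the main constant: `l ≤ e^{2δ} c_max 4^δ`. [folklore] -/
def cfLmax : ℝ := Real.exp (2 * cfDimension A) * (cfCmax A hA h2 * (4 : ℝ) ^ cfDimension A)

/-- **The constant of the theorem**, affine in `M` with coefficients depending only on `A, σ₁, κ`. [folklore] -/
def cfPSConst (σ₁ κ M : ℝ) : ℝ :=
  (A.card : ℝ) ^ 2 * (1 + cfK0 A hA h2 σ₁ κ M) +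
    2 * (13 * (2 * cfDimension A) * Real.exp (2 * cfDimension A) * (cfCmax A hA h2 * (4 : ℝ) ^ cfDimension A)) +
    cfKst A hA h2 σ₁ κ M * (Real.exp (2 * cfDimension A) * (4 : ℝ) ^ cfDimension A *
      Real.exp (2 * (2 * ((cfDimension A - σ₁) / 3)) * Real.log ((A.sup id : ℕ) + 1))) +
    (cfC2 A hA h2 + cfLmax A hA h2) * cfPSR0 A ^ cfPSExp A σ₁

/-- `c₀ > 0`. [folklore] -/
theorem cfPSc0_pos (hA : ∀ a ∈ A, 1 ≤ a) (h2 : 2 ≤ A.card) : 0 < cfPSc0 A := by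
  have hδ := cfDimension_pos hA h2
  have hcard : (2 : ℝ) ≤ A.card := by exact_mod_cast h2
  have hlog : 0 < Real.log A.card := Real.log_pos (by linarith)
  have hB : (1 : ℝ) ≤ (A.sup id : ℕ) := by
    obtain ⟨a, ha⟩ := nonempty_of_two_le_card h2
    have h1 : 1 ≤ A.sup id := (hA a ha).trans (Finset.le_sup (f := id) ha)
    exact_mod_cast h1
  have hlogB : 0 < Real.log ((A.sup id : ℕ) + 1) := Real.log_pos (by linarith)
  unfold cfPSc0
  exact lt_min (div_pos hδ hlog) (by positivity)

/-- `η > 0` for `σ₁ < δ`. [folklore] -/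
theorem cfPSExp_pos (hA : ∀ a ∈ A, 1 ≤ a) (h2 : 2 ≤ A.card) {σ₁ : ℝ} (hσ₁ : σ₁ < cfDimension A) : 0 < cfPSExp A σ₁ := by
  have hc := cfPSc0_pos A hA h2
  have hδ := cfDimension_pos hA h2
  unfold cfPSExp
  exact lt_min (lt_min hδ (mul_pos hc (Real.log_pos (by norm_num)))) (by linarith)

end Constants

/-! ### The theorem -/

/-- **Power saving for the congruence Frobenius-ball count at level `q` from operator bounds** (see the module docstring).
For `l` bracketed by the per-suffix constants and all `R ≥ 1`:
`|cfCount A q ξ R − l R^{2δ_A}| ≤ cfPSConst(M) · R^{2δ_A − cfPSExp}`, the constant affine in `M` with coefficients depending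
only on `A, σ₁, κ`, the exponent `cfPSExp A σ₁ > 0` depending only on `A, σ₁`.
[cite: MageeOhWinter2019, Thm. 11 and §3.4 (after Prop. 17), given Thm. 4] -/
theorem abs_cfCount_sub_le_of_operatorBound (hA : ∀ a ∈ A, 1 ≤ a) (h2 : 2 ≤ A.card) {q : ℕ} [NeZero q]
    {σ₀ σ₁ : ℝ} (hσ₀ : 0 ≤ σ₀) (hσ₀₁ : σ₀ < σ₁) (hσ₁ : σ₁ < cfDimension A)
    (hL1 : ∀ s : ℂ, σ₀ < s.re → s ≠ (cfDimension A : ℂ) → IsUnit (1 - cfLOp A hA s))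
    (hL2 : ∀ s : ℂ, σ₀ < s.re → IsUnit (1 + cfLOp A hA s))
    (hB : ∀ s : ℂ, σ₀ < s.re → IsUnit (1 - cfTwB A hA q s))
    {κ M : ℝ} (hκ0 : 0 ≤ κ) (hκ : κ < 2) (hM : 0 ≤ M)
    (hop : ∀ u : ℝ, σ₁ ≤ u → u ≤ cfDimension A + 1 → ∀ t : ℝ, (u : ℂ) + t * I ≠ (cfDimension A : ℂ) →
      ∀ (η : SL(2, ZMod q)) (y : Icc (0 : ℝ) 1),
        ‖(cfTwHop A hA h2 q ((u : ℂ) + t * I) (cfFamS q cfΘ₀ (CfLip.const 1) 1 ((u : ℂ) + t * I))) η y‖ ≤ M * (1 + |t|) ^ κ)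
    (ξ : SL(2, ZMod q)) {l : ℝ}
    (hl : ∀ N : ℕ, Even N → N ≠ 0 → cfEtaBar N ≤ 1 / 16 →
      ((Fintype.card (SL(2, ZMod q)) : ℝ))⁻¹ * cfClassLower A hA h2 N ≤ l ∧
        l ≤ ((Fintype.card (SL(2, ZMod q)) : ℝ))⁻¹ * cfClassUpper A hA h2 N)
    {R : ℝ} (hR : 1 ≤ R) :
    |(cfCount A q ξ R : ℝ) - l * R ^ (2 * cfDimension A)| ≤
      cfPSConst A hA h2 σ₁ κ M * R ^ (2 * cfDimension A - cfPSExp A σ₁) := by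
  have hne := nonempty_of_two_le_card h2
  have hδ := cfDimension_pos hA h2
  have hσ₁0 : 0 < σ₁ := lt_of_le_of_lt hσ₀ hσ₀₁
  have hR0 : 0 < R := by linarith
  have hc₀ := cfPSc0_pos A hA h2
  have hη' := cfPSExp_pos A hA h2 hσ₁
  have hKst := cfKst_nonneg hA h2 (κ := κ) hσ₁0 hM
  have hcmax := (cfCmax_pos A hA h2).le
  have hK0 : 0 ≤ cfK0 A hA h2 σ₁ κ M := by unfold cfK0; positivity
  have hcard : (2 : ℝ) ≤ A.card := by exact_mod_cast h2
  have hlogA : 0 < Real.log A.card := Real.log_pos (by linarith)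
  have hB1 : (1 : ℝ) ≤ (A.sup id : ℕ) := by
    obtain ⟨a, ha⟩ := hne
    have h1 : 1 ≤ A.sup id := (hA a ha).trans (Finset.le_sup (f := id) ha)
    exact_mod_cast h1
  have hLB : 0 < Real.log ((A.sup id : ℕ) + 1) := Real.log_pos (by linarith)
  -- abbreviations
  obtain ⟨p, hp⟩ : ∃ p : ℝ, p = 2 * cfDimension A := ⟨_, rfl⟩
  obtain ⟨θ, hθ⟩ : ∃ θ : ℝ, θ = 2 * ((cfDimension A - σ₁) / 3) := ⟨_, rfl⟩
  obtain ⟨η', hη'def⟩ : ∃ η' : ℝ, η' = cfPSExp A σ₁ := ⟨_, rfl⟩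
  have hθ0 : 0 ≤ θ := by rw [hθ]; linarith
  have hη'0 : 0 < η' := by rw [hη'def]; exact hη'
  have hη'δ : η' ≤ cfDimension A := by rw [hη'def, cfPSExp]; exact (min_le_left _ _).trans (min_le_left _ _)
  have hη'c : η' ≤ cfPSc0 A * Real.log 2 := by rw [hη'def, cfPSExp]; exact (min_le_left _ _).trans (min_le_right _ _)
  have hη'θ : η' ≤ θ / 2 := by rw [hη'def, cfPSExp, hθ]; refine (min_le_right _ _).trans (le_of_eq (by ring))
  rw [← hη'def]
  -- `l ≥ 0` and `l ≤ l_max` (from `N = 6`)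
  have hη6 : cfEtaBar 6 ≤ 1 / 16 := by unfold cfEtaBar; norm_num
  obtain ⟨hl6L, hl6U⟩ := hl 6 (by decide) (by norm_num) hη6
  have hci0 : 0 ≤ ((Fintype.card (SL(2, ZMod q)) : ℝ))⁻¹ := by positivity
  have hci1 : ((Fintype.card (SL(2, ZMod q)) : ℝ))⁻¹ ≤ 1 := inv_le_one_of_one_le₀ (by exact_mod_cast Fintype.card_pos)
  have hL60 : 0 ≤ cfClassLower A hA h2 6 := by
    rw [cfClassLower_eq_sum hA h2]
    exact Finset.sum_nonneg fun v _ => mul_nonneg (rpow_nonneg (cfAMinus_nonneg 6 v) _) (cfEvenConst_one_nonneg A hA h2 _)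
  have hl0 : 0 ≤ l := le_trans (mul_nonneg hci0 hL60) hl6L
  have hlmax : l ≤ cfLmax A hA h2 := by
    have hU6 : cfClassUpper A hA h2 6 ≤ cfLmax A hA h2 := by
      rw [cfClassUpper_eq A hA h2 6, cfLmax]
      refine mul_le_mul (Real.exp_le_exp.2 ?_) (cfClassLower_le A hA h2 6) ?_ (Real.exp_pos _).le
      · have := cfEtaBar_nonneg 6; nlinarith
      · exact hL60
    have hU60 : 0 ≤ cfClassUpper A hA h2 6 := by
      rw [cfClassUpper_eq_sum hA h2]
      exact Finset.sum_nonneg fun v _ => mul_nonneg (rpow_nonneg (cfAPlus_nonneg 6 v) _) (cfEvenConst_one_nonneg A hA h2 _)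
    calc l ≤ ((Fintype.card (SL(2, ZMod q)) : ℝ))⁻¹ * cfClassUpper A hA h2 6 := hl6U
      _ ≤ 1 * cfClassUpper A hA h2 6 := mul_le_mul_of_nonneg_right hci1 hU60
      _ ≤ cfLmax A hA h2 := by rw [one_mul]; exact hU6
  -- the power of `R`
  have hRpow : ∀ e : ℝ, η' ≤ e → R ^ (p - e) ≤ R ^ (p - η') := fun e he => Real.rpow_le_rpow_of_exponent_le hR (by linarith)
  have hRpη : 0 ≤ R ^ (p - η') := rpow_nonneg hR0.le _
  by_cases hRR : cfPSR0 A ≤ R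
  · -- large `R`: choose `N = 2⌈c₀ log R / 2⌉`
    have hlogR : 6 / cfPSc0 A ≤ Real.log R := by
      rw [← Real.log_exp (6 / cfPSc0 A)]; exact Real.log_le_log (Real.exp_pos _) hRR
    have hx6 : 6 ≤ cfPSc0 A * Real.log R := by
      rw [div_le_iff₀ hc₀] at hlogR; linarith
    set N : ℕ := 2 * ⌈cfPSc0 A * Real.log R / 2⌉₊ with hNdef
    have hNge : cfPSc0 A * Real.log R ≤ (N : ℝ) := by
      rw [hNdef]; push_cast
      have := Nat.le_ceil (cfPSc0 A * Real.log R / 2)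
      linarith
    have hNle : (N : ℝ) ≤ cfPSc0 A * Real.log R + 2 := by
      rw [hNdef]; push_cast
      have := Nat.ceil_lt_add_one (show 0 ≤ cfPSc0 A * Real.log R / 2 by positivity)
      linarith
    have hNev : Even N := even_two_mul _
    have hN6 : 6 ≤ N := by
      have : (6 : ℝ) ≤ (N : ℝ) := hx6.trans hNge
      exact_mod_cast this
    have hN0 : N ≠ 0 := by omega
    have hηN : cfEtaBar N ≤ 1 / 16 := by
      unfold cfEtaBar
      calc (1 / 2 : ℝ) ^ (N - 1) ≤ (1 / 2 : ℝ) ^ 5 := pow_le_pow_of_le_one (by norm_num) (by norm_num) (by omega)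
        _ ≤ 1 / 16 := by norm_num
    obtain ⟨hlL, hlU⟩ := hl N hNev hN0 hηN
    have hfix := abs_cfCount_sub_le_fixedN hA h2 hσ₀ hσ₀₁ hσ₁ hL1 hL2 hB hκ0 hκ hM hop ξ hNev hN0 hηN hlL hlU hR0.le
    rw [← hp, ← hθ] at hfix
    -- the three estimates
    have hb1 : (A.card : ℝ) ^ N ≤ (A.card : ℝ) ^ 2 * R ^ (cfDimension A) :=
      pow_le_sq_mul_rpow (by linarith) hR hNle (by
        have h := min_le_left (cfDimension A / Real.log A.card) (1 / (2 * Real.log ((A.sup id : ℕ) + 1)))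
        rw [← cfPSc0] at h
        calc cfPSc0 A * Real.log A.card ≤ cfDimension A / Real.log A.card * Real.log A.card :=
            mul_le_mul_of_nonneg_right h hlogA.le
          _ = cfDimension A := div_mul_cancel₀ _ hlogA.ne')
    have hb2 : cfEtaBar N ≤ 2 * R ^ (-(cfPSc0 A * Real.log 2)) := cfEtaBar_le_rpow hR (by omega) hNge
    have hb3 : Real.exp (N * (θ * Real.log ((A.sup id : ℕ) + 1))) ≤
        Real.exp (2 * θ * Real.log ((A.sup id : ℕ) + 1)) * R ^ (θ / 2) :=
      exp_mul_le_rpow hR hθ0 hLB.le hNle (by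
        have h := min_le_right (cfDimension A / Real.log A.card) (1 / (2 * Real.log ((A.sup id : ℕ) + 1)))
        rw [← cfPSc0] at h
        calc cfPSc0 A * Real.log ((A.sup id : ℕ) + 1) ≤ 1 / (2 * Real.log ((A.sup id : ℕ) + 1)) * Real.log ((A.sup id : ℕ) + 1) :=
            mul_le_mul_of_nonneg_right h hLB.le
          _ = 1 / 2 := by field_simp)
    -- powers of `R`
    have hpow1 : R ^ (cfDimension A) ≤ R ^ (p - η') := by
      have := hRpow (cfDimension A) hη'δ; rwa [show p - cfDimension A = cfDimension A by rw [hp]; ring] at this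
    have hpow2 : R ^ (-(cfPSc0 A * Real.log 2)) * R ^ p ≤ R ^ (p - η') := by
      rw [← Real.rpow_add hR0]; have := hRpow _ hη'c; rwa [show p - cfPSc0 A * Real.log 2 = -(cfPSc0 A * Real.log 2) + p by ring] at this
    have hpow3 : R ^ (θ / 2) * R ^ (p - θ) ≤ R ^ (p - η') := by
      rw [← Real.rpow_add hR0]; have := hRpow _ hη'θ; rwa [show p - θ / 2 = θ / 2 + (p - θ) by ring] at this
    -- assemble
    have hE0 : 0 ≤ 13 * p * Real.exp p * (cfCmax A hA h2 * (4 : ℝ) ^ cfDimension A) := by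
      have : 0 ≤ p := by rw [hp]; linarith
      positivity
    have hT1 : (A.card : ℝ) ^ N * (1 + cfK0 A hA h2 σ₁ κ M) ≤ (A.card : ℝ) ^ 2 * (1 + cfK0 A hA h2 σ₁ κ M) * R ^ (p - η') := by
      calc (A.card : ℝ) ^ N * (1 + cfK0 A hA h2 σ₁ κ M) ≤ (A.card : ℝ) ^ 2 * R ^ (cfDimension A) * (1 + cfK0 A hA h2 σ₁ κ M) :=
            mul_le_mul_of_nonneg_right hb1 (by positivity)
        _ ≤ (A.card : ℝ) ^ 2 * R ^ (p - η') * (1 + cfK0 A hA h2 σ₁ κ M) := by gcongr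
        _ = _ := by ring
    have hT2 : 13 * p * Real.exp p * (cfCmax A hA h2 * (4 : ℝ) ^ cfDimension A) * cfEtaBar N * R ^ p ≤
        2 * (13 * p * Real.exp p * (cfCmax A hA h2 * (4 : ℝ) ^ cfDimension A)) * R ^ (p - η') := by
      calc 13 * p * Real.exp p * (cfCmax A hA h2 * (4 : ℝ) ^ cfDimension A) * cfEtaBar N * R ^ p
          ≤ 13 * p * Real.exp p * (cfCmax A hA h2 * (4 : ℝ) ^ cfDimension A) * (2 * R ^ (-(cfPSc0 A * Real.log 2))) * R ^ p := by
            gcongr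
        _ = 2 * (13 * p * Real.exp p * (cfCmax A hA h2 * (4 : ℝ) ^ cfDimension A)) * (R ^ (-(cfPSc0 A * Real.log 2)) * R ^ p) := by
            ring
        _ ≤ _ := mul_le_mul_of_nonneg_left hpow2 (by positivity)
    have hT3 : cfKst A hA h2 σ₁ κ M * (Real.exp p * (4 : ℝ) ^ cfDimension A * Real.exp (N * (θ * Real.log ((A.sup id : ℕ) + 1)))) *
        R ^ (p - θ) ≤ cfKst A hA h2 σ₁ κ M * (Real.exp p * (4 : ℝ) ^ cfDimension A *
          Real.exp (2 * θ * Real.log ((A.sup id : ℕ) + 1))) * R ^ (p - η') := by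
      calc cfKst A hA h2 σ₁ κ M * (Real.exp p * (4 : ℝ) ^ cfDimension A * Real.exp (N * (θ * Real.log ((A.sup id : ℕ) + 1)))) *
            R ^ (p - θ)
          ≤ cfKst A hA h2 σ₁ κ M * (Real.exp p * (4 : ℝ) ^ cfDimension A *
              (Real.exp (2 * θ * Real.log ((A.sup id : ℕ) + 1)) * R ^ (θ / 2))) * R ^ (p - θ) := by
            gcongr
        _ = cfKst A hA h2 σ₁ κ M * (Real.exp p * (4 : ℝ) ^ cfDimension A * Real.exp (2 * θ * Real.log ((A.sup id : ℕ) + 1))) *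
              (R ^ (θ / 2) * R ^ (p - θ)) := by ring
        _ ≤ _ := mul_le_mul_of_nonneg_left hpow3 (by positivity)
    have hK4 : 0 ≤ (cfC2 A hA h2 + cfLmax A hA h2) * cfPSR0 A ^ η' :=
      mul_nonneg (add_nonneg (cfC2_spec A hA h2).1.le (hl0.trans hlmax)) (rpow_nonneg (Real.exp_pos _).le _)
    have hfinal : |(cfCount A q ξ R : ℝ) - l * R ^ p| ≤
        ((A.card : ℝ) ^ 2 * (1 + cfK0 A hA h2 σ₁ κ M) + 2 * (13 * p * Real.exp p * (cfCmax A hA h2 * (4 : ℝ) ^ cfDimension A)) +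
          cfKst A hA h2 σ₁ κ M * (Real.exp p * (4 : ℝ) ^ cfDimension A * Real.exp (2 * θ * Real.log ((A.sup id : ℕ) + 1))) +
          (cfC2 A hA h2 + cfLmax A hA h2) * cfPSR0 A ^ η') * R ^ (p - η') := by
      linarith [hfix, hT1, hT2, hT3, mul_nonneg hK4 hRpη]
    rw [hp, hθ] at hfinal
    rw [cfPSConst, ← hη'def]
    exact hfinal
  · -- small `R`: the trivial bound
    rw [not_le] at hRR
    have hcnt := (cfC2_spec A hA h2).2 q ξ R hR
    have hcnt0 : (0 : ℝ) ≤ (cfCount A q ξ R : ℝ) := Nat.cast_nonneg _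
    have hRp : R ^ p ≤ cfPSR0 A ^ η' * R ^ (p - η') := by
      rw [show R ^ p = R ^ η' * R ^ (p - η') by rw [← Real.rpow_add hR0]; ring_nf]
      exact mul_le_mul_of_nonneg_right (Real.rpow_le_rpow hR0.le hRR.le hη'0.le) hRpη
    rw [← hp] at hcnt
    have h1 : |(cfCount A q ξ R : ℝ) - l * R ^ p| ≤ (cfC2 A hA h2 + cfLmax A hA h2) * R ^ p := by
      rw [abs_le]; constructor
      · linarith [mul_le_mul_of_nonneg_right hlmax (rpow_nonneg hR0.le p),
          mul_nonneg (cfC2_spec A hA h2).1.le (rpow_nonneg hR0.le p)]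
      · linarith [mul_nonneg hl0 (rpow_nonneg hR0.le p), mul_nonneg (hl0.trans hlmax) (rpow_nonneg hR0.le p)]
    have h2'' : (cfC2 A hA h2 + cfLmax A hA h2) * R ^ p ≤ (cfC2 A hA h2 + cfLmax A hA h2) * cfPSR0 A ^ η' * R ^ (p - η') := by
      rw [mul_assoc]; exact mul_le_mul_of_nonneg_left hRp (add_nonneg (cfC2_spec A hA h2).1.le (hl0.trans hlmax))
    have hrest : 0 ≤ ((A.card : ℝ) ^ 2 * (1 + cfK0 A hA h2 σ₁ κ M) +
        2 * (13 * (2 * cfDimension A) * Real.exp (2 * cfDimension A) * (cfCmax A hA h2 * (4 : ℝ) ^ cfDimension A)) +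
        cfKst A hA h2 σ₁ κ M * (Real.exp (2 * cfDimension A) * (4 : ℝ) ^ cfDimension A *
          Real.exp (2 * (2 * ((cfDimension A - σ₁) / 3)) * Real.log ((A.sup id : ℕ) + 1)))) * R ^ (p - η') := by
      positivity
    rw [hp] at h1 h2'' hrest
    rw [cfPSConst, ← hη'def]
    linarith [h1, h2'', hrest]

/-! ### The bracket hypothesis from the existence of the limit; the coprime-level form -/

/-- **The limit is bracketed:** for primitive twists, if `cfCount A q ξ R / R^{2δ} → l` then
`|Γ_q|^{-1} L_N ≤ l ≤ |Γ_q|^{-1} U_N` for every even `N ≠ 0` with `η̄_N ≤ 1/16`. [cite: MageeOhWinter2019, Thm. 11] -/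
theorem bracket_of_tendsto (hA : ∀ a ∈ A, 1 ≤ a) (h2 : 2 ≤ A.card) (q : ℕ) [NeZero q] {n₀ : ℕ}
    (hprim : ∀ n ≥ n₀, ∀ ξ η : SL(2, ZMod q), ∃ w : List (A × A), w.length = n ∧ ξ * cfSigmaWord A q w = η)
    (ξ : SL(2, ZMod q)) {l : ℝ} (hl : Tendsto (fun R => (cfCount A q ξ R : ℝ) / R ^ (2 * cfDimension A)) atTop (𝓝 l))
    (N : ℕ) (hNev : Even N) (hN0 : N ≠ 0) (hη : cfEtaBar N ≤ 1 / 16) :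
    ((Fintype.card (SL(2, ZMod q)) : ℝ))⁻¹ * cfClassLower A hA h2 N ≤ l ∧
      l ≤ ((Fintype.card (SL(2, ZMod q)) : ℝ))⁻¹ * cfClassUpper A hA h2 N := by
  obtain ⟨-, -, h⟩ := congr_class_bounds A hA h2 q hprim ξ
  obtain ⟨hL, hU⟩ := h N hNev hN0 hη
  rw [hl.liminf_eq] at hL
  rw [hl.limsup_eq] at hU
  exact ⟨hL, hU⟩

/-- **Power saving at a level `q` coprime to `6` and to `b − a` (`a, b ∈ A`), from operator bounds:** with the `q`-independent
constant `c` of the main term (`cfCount_congr_tendsto`), for all `ξ` and `R ≥ 1`,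
`|cfCount A q ξ R − c R^{2δ}/#SL₂(ℤ/qℤ)| ≤ cfPSConst(M) R^{2δ − cfPSExp}` — the inequality of
`MageeOhWinter2019_uniformCounting` at level `q`, given the hypotheses of [MageeOhWinter2019, Thm. 4] in resolvent form.
[cite: MageeOhWinter2019, Thm. 1, Thm. 11, §3.4] -/
theorem abs_cfCount_sub_le_of_operatorBound_coprime (hA : ∀ a ∈ A, 1 ≤ a) (h2 : 2 ≤ A.card) {a b : ℕ} (ha : a ∈ A)
    (hb : b ∈ A) {q : ℕ} [NeZero q] (hq6 : Nat.Coprime q 6) (hq : IsCoprime ((b : ℤ) - a) q)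
    {σ₀ σ₁ : ℝ} (hσ₀ : 0 ≤ σ₀) (hσ₀₁ : σ₀ < σ₁) (hσ₁ : σ₁ < cfDimension A)
    (hL1 : ∀ s : ℂ, σ₀ < s.re → s ≠ (cfDimension A : ℂ) → IsUnit (1 - cfLOp A hA s))
    (hL2 : ∀ s : ℂ, σ₀ < s.re → IsUnit (1 + cfLOp A hA s))
    (hB : ∀ s : ℂ, σ₀ < s.re → IsUnit (1 - cfTwB A hA q s))
    {κ M : ℝ} (hκ0 : 0 ≤ κ) (hκ : κ < 2) (hM : 0 ≤ M)
    (hop : ∀ u : ℝ, σ₁ ≤ u → u ≤ cfDimension A + 1 → ∀ t : ℝ, (u : ℂ) + t * I ≠ (cfDimension A : ℂ) →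
      ∀ (η : SL(2, ZMod q)) (y : Icc (0 : ℝ) 1),
        ‖(cfTwHop A hA h2 q ((u : ℂ) + t * I) (cfFamS q cfΘ₀ (CfLip.const 1) 1 ((u : ℂ) + t * I))) η y‖ ≤ M * (1 + |t|) ^ κ) :
    ∃ c : ℝ, 0 < c ∧ Tendsto (fun R : ℝ => (cfCount A 1 1 R : ℝ) / R ^ (2 * cfDimension A)) atTop (𝓝 c) ∧
      ∀ (ξ : SL(2, ZMod q)) (R : ℝ), 1 ≤ R →
        |(cfCount A q ξ R : ℝ) - c * R ^ (2 * cfDimension A) / (Fintype.card (SL(2, ZMod q)) : ℝ)| ≤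
          cfPSConst A hA h2 σ₁ κ M * R ^ (2 * cfDimension A - cfPSExp A σ₁) := by
  obtain ⟨c, hc, h1, hq'⟩ := cfCount_congr_tendsto hA h2 ha hb hq6 hq
  obtain ⟨n₀, hprim⟩ := cfTwist_primitive ha hb hq6 hq
  refine ⟨c, hc, h1, fun ξ R hR => ?_⟩
  have h := abs_cfCount_sub_le_of_operatorBound hA h2 hσ₀ hσ₀₁ hσ₁ hL1 hL2 hB hκ0 hκ hM hop ξ
    (fun N hNev hN0 hη => bracket_of_tendsto hA h2 q hprim ξ (hq' ξ) N hNev hN0 hη) hR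
  rwa [show c / (Fintype.card (SL(2, ZMod q)) : ℝ) * R ^ (2 * cfDimension A) =
    c * R ^ (2 * cfDimension A) / (Fintype.card (SL(2, ZMod q)) : ℝ) by ring] at h

/-! ### The constant is affine in `M`; the reduction of the named fact to level-uniform operator bounds -/

section Affine

variable (A) (hA : ∀ a ∈ A, 1 ≤ a) (h2 : 2 ≤ A.card)

/-- The slope of `M ↦ cfPSConst(M)`. [folklore] -/
def cfPSSlope (σ₁ κ : ℝ) : ℝ :=
  cfKM σ₁ κ * ((A.card : ℝ) ^ 2 * (2 : ℝ) ^ cfDimension A + Real.exp (2 * cfDimension A) * (4 : ℝ) ^ cfDimension A *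
    Real.exp (2 * (2 * ((cfDimension A - σ₁) / 3)) * Real.log ((A.sup id : ℕ) + 1)))

/-- `cfPSConst(M) = cfPSConst(0) + M · cfPSSlope`. [folklore] -/
theorem cfPSConst_eq_affine (σ₁ κ M : ℝ) :
    cfPSConst A hA h2 σ₁ κ M = cfPSConst A hA h2 σ₁ κ 0 + M * cfPSSlope A σ₁ κ := by
  unfold cfPSConst cfK0 cfKst cfPSSlope; ring

/-- `cfPSSlope ≥ 0`. [folklore] -/
theorem cfPSSlope_nonneg {σ₁ κ : ℝ} (hσ₁ : 0 < σ₁) : 0 ≤ cfPSSlope A σ₁ κ := by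
  unfold cfPSSlope; have := cfKM_nonneg (κ := κ) hσ₁; positivity

/-- `cfPSConst(0) ≥ 0`. [folklore] -/
theorem cfPSConst_zero_nonneg {σ₁ κ : ℝ} (hσ₁ : 0 < σ₁) : 0 ≤ cfPSConst A hA h2 σ₁ κ 0 := by
  have hKst := cfKst_nonneg hA h2 (κ := κ) hσ₁ le_rfl
  have hcmax := (cfCmax_pos A hA h2).le
  have hδ := cfDimension_pos hA h2
  have hK0 : 0 ≤ cfK0 A hA h2 σ₁ κ 0 := by unfold cfK0; positivity
  have hC2 := (cfC2_spec A hA h2).1.le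
  have hL : 0 ≤ cfLmax A hA h2 := by unfold cfLmax; positivity
  have hR0 : 0 ≤ cfPSR0 A ^ cfPSExp A σ₁ := rpow_nonneg (Real.exp_pos _).le _
  unfold cfPSConst; positivity

end Affine

/-- **The named fact for `A` from level-uniform operator bounds (the formal content of [MageeOhWinter2019, Thm. 4] in resolvent
form).** Suppose: `1 − L_s` is a unit for `Re s > σ₀`, `s ≠ δ_A`, and `1 + L_s` for `Re s > σ₀` (`0 ≤ σ₀ < σ₁ < δ_A`); and for every
level `q` coprime to `Q₁`, `1 − B_{s,q}` is a unit for `Re s > σ₀` and the regular part of the twisted resolvent obeys the sup-norm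
bound `‖(H_op(u+it)(Φ₀^{-2(u+it)} ⊗ δ_1))_η(y)‖ ≤ K_c q^C (1+|t|)^κ` on `σ₁ ≤ u ≤ δ_A + 1` (`0 ≤ κ < 2`). Then the conclusion of
`MageeOhWinter2019_uniformCounting` holds for `A`: with `Q₀ = Q₁ · 6|b − a|` (`a ≠ b ∈ A`), the `q`-independent `c` of Thm. 1,
`ε = cfPSExp A σ₁`, exponent `C + 1` and an explicit `K`. [cite: MageeOhWinter2019, Thm. 1, Thm. 4, Thm. 11, §3.4] -/
theorem uniformCounting_of_operatorBounds (hA : ∀ a ∈ A, 1 ≤ a) (h2 : 2 ≤ A.card) {a b : ℕ} (ha : a ∈ A) (hb : b ∈ A)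
    (hab : a ≠ b) {σ₀ σ₁ κ Kc C : ℝ} (hσ₀ : 0 ≤ σ₀) (hσ₀₁ : σ₀ < σ₁) (hσ₁ : σ₁ < cfDimension A) (hκ0 : 0 ≤ κ) (hκ : κ < 2)
    (hKc : 0 ≤ Kc) (hC : 0 ≤ C) {Q₁ : ℕ} (hQ₁ : 0 < Q₁)
    (hL1 : ∀ s : ℂ, σ₀ < s.re → s ≠ (cfDimension A : ℂ) → IsUnit (1 - cfLOp A hA s))
    (hL2 : ∀ s : ℂ, σ₀ < s.re → IsUnit (1 + cfLOp A hA s))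
    (hBq : ∀ (q : ℕ) [NeZero q], Nat.Coprime q Q₁ → ∀ s : ℂ, σ₀ < s.re → IsUnit (1 - cfTwB A hA q s))
    (hopq : ∀ (q : ℕ) [NeZero q], Nat.Coprime q Q₁ → ∀ u : ℝ, σ₁ ≤ u → u ≤ cfDimension A + 1 → ∀ t : ℝ,
      (u : ℂ) + t * I ≠ (cfDimension A : ℂ) → ∀ (η : SL(2, ZMod q)) (y : Icc (0 : ℝ) 1),
        ‖(cfTwHop A hA h2 q ((u : ℂ) + t * I) (cfFamS q cfΘ₀ (CfLip.const 1) 1 ((u : ℂ) + t * I))) η y‖ ≤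
          Kc * (q : ℝ) ^ C * (1 + |t|) ^ κ) :
    0 < cfDimension A ∧ ∃ Q₀ : ℕ, 0 < Q₀ ∧ ∃ c : ℝ, 0 < c ∧ ∃ C' : ℝ, 0 < C' ∧ ∃ ε : ℝ, 0 < ε ∧ ∃ K : ℝ, 0 ≤ K ∧
      ∀ q : ℕ, 0 < q → Nat.Coprime q Q₀ → ∀ (ξ : SL(2, ZMod q)) (R : ℝ), 1 ≤ R →
        |(cfCount A q ξ R : ℝ) - c * R ^ (2 * cfDimension A) / (Nat.card (SL(2, ZMod q)) : ℝ)| ≤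
          K * (q : ℝ) ^ C' * R ^ (2 * cfDimension A - ε) := by
  have hδ := cfDimension_pos hA h2
  have hσ₁0 : 0 < σ₁ := lt_of_le_of_lt hσ₀ hσ₀₁
  -- the `q`-independent constant, from level `1`
  obtain ⟨c, hc, hc1, -⟩ := cfCount_congr_tendsto hA h2 ha hb (q := 1) (Nat.coprime_one_left 6) isCoprime_one_right
  set d : ℕ := Int.natAbs ((b : ℤ) - a) with hd
  have hd0 : 0 < d := Int.natAbs_pos.2 (sub_ne_zero.2 (by exact_mod_cast hab.symm))
  refine ⟨hδ, Q₁ * (6 * d), by positivity, c, hc, C + 1, by linarith, cfPSExp A σ₁, cfPSExp_pos A hA h2 hσ₁,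
    cfPSConst A hA h2 σ₁ κ 0 + Kc * cfPSSlope A σ₁ κ,
    add_nonneg (cfPSConst_zero_nonneg A hA h2 (κ := κ) hσ₁0) (mul_nonneg hKc (cfPSSlope_nonneg A hσ₁0)),
    fun q hq hcop ξ R hR => ?_⟩
  haveI : NeZero q := ⟨hq.ne'⟩
  -- coprimality consequences
  have hq1 : Nat.Coprime q Q₁ := Nat.Coprime.coprime_mul_right_right hcop
  have hq6d : Nat.Coprime q (6 * d) := Nat.Coprime.coprime_mul_left_right hcop
  have hq6 : Nat.Coprime q 6 := Nat.Coprime.coprime_mul_right_right hq6d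
  have hqd : Nat.Coprime q d := Nat.Coprime.coprime_mul_left_right hq6d
  have hqI : IsCoprime ((b : ℤ) - a) q := by
    rw [Int.isCoprime_iff_gcd_eq_one, Int.gcd_comm]
    have : Int.gcd (q : ℤ) ((b : ℤ) - a) = Nat.gcd q d := by
      rw [hd, Int.gcd_eq_natAbs]; simp
    rw [this]
    exact Nat.Coprime.gcd_eq_one hqd
  -- the level-`q` theorem with `M = K_c q^C`
  have hM : 0 ≤ Kc * (q : ℝ) ^ C := by positivity
  obtain ⟨c', -, hc'1, hbound⟩ := abs_cfCount_sub_le_of_operatorBound_coprime hA h2 ha hb hq6 hqI hσ₀ hσ₀₁ hσ₁ hL1 hL2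
    (hBq q hq1) hκ0 hκ hM (hopq q hq1)
  have hcc : c' = c := tendsto_nhds_unique hc'1 hc1
  have h := hbound ξ R hR
  rw [hcc, ← Nat.card_eq_fintype_card] at h
  refine h.trans ?_
  -- the constant: `cfPSConst(K_c q^C) ≤ (cfPSConst(0) + K_c · slope) q^{C+1}`
  have hRpow : 0 ≤ R ^ (2 * cfDimension A - cfPSExp A σ₁) := rpow_nonneg (by linarith) _
  refine mul_le_mul_of_nonneg_right ?_ hRpow
  have hq1' : (1 : ℝ) ≤ q := by exact_mod_cast hq
  have hqC : (1 : ℝ) ≤ (q : ℝ) ^ C := one_le_rpow hq1' hC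
  have hqC1 : (q : ℝ) ^ C ≤ (q : ℝ) ^ (C + 1) := Real.rpow_le_rpow_of_exponent_le hq1' (by linarith)
  have hP0 := cfPSConst_zero_nonneg A hA h2 (κ := κ) hσ₁0
  have hS := cfPSSlope_nonneg A (κ := κ) hσ₁0
  rw [cfPSConst_eq_affine A hA h2 σ₁ κ (Kc * (q : ℝ) ^ C)]
  calc cfPSConst A hA h2 σ₁ κ 0 + Kc * (q : ℝ) ^ C * cfPSSlope A σ₁ κ
      ≤ cfPSConst A hA h2 σ₁ κ 0 * (q : ℝ) ^ C + Kc * (q : ℝ) ^ C * cfPSSlope A σ₁ κ := by nlinarith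
    _ = (cfPSConst A hA h2 σ₁ κ 0 + Kc * cfPSSlope A σ₁ κ) * (q : ℝ) ^ C := by ring
    _ ≤ (cfPSConst A hA h2 σ₁ κ 0 + Kc * cfPSSlope A σ₁ κ) * (q : ℝ) ^ (C + 1) :=
        mul_le_mul_of_nonneg_left hqC1 (add_nonneg hP0 (mul_nonneg hKc hS))

end Literature.NumberTheory.Sieve
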